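import Summits.QuantumFields.YangMills.Theses.EntropyBudgetEquipartition

/-!
# Route `EntropyBudgetEquipartition`, item `Assembly` (stmt-QuantumFields-22404): PROVED

`Assembly : FreeEnergyRate → EntropyBudgetTransfer → FloorOfLocalLaw → XiPow`.

Pointwise in `(G, r)`: K1 (`FreeEnergyRate`) gives the free-energy rate, KT (`EntropyBudgetTransfer`) turns it
into the two-sided local law, S (`FloorOfLocalLaw`) extracts `PolySeparationPlaquetteFloor 4 r.ρ 1 2 A' κ'`, and
the tree's kernel glue `WeakCouplingRates.massGapPowerDecayOf_of_polySeparationFloor` (spatial plane `(1,2)`,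
`r.continuous`) gives `MassGapPowerDecayOf 4 r.ρ (A'/2)`, i.e. the all-`G` leaf `XiPow` with `ε = A'/2`.

HONEST LABEL. This is the bookkeeping implication only (8 lines); it proves neither `FreeEnergyRate` nor
`EntropyBudgetTransfer`; `XiPow` is an UPPER bound on the lattice gap (RECORD-label rung R2ξ-G), NOT the Clay
mass gap, and nothing here bears on the summit statement.
-/

namespace Summit.QuantumFields.YangMills.Theorems

open Literature.MathematicalPhysics.QuantumFieldTheory Literature.MathematicalPhysics.QuantumLattice
open Summit.QuantumFields.YangMills.Theorems.WeakCouplingRates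

/-- **Assembly of route `EntropyBudgetEquipartition`** (item stmt-QuantumFields-22404): the three items compose to
the all-`G` rates leaf `XiPow` through the kernel glue `massGapPowerDecayOf_of_polySeparationFloor`
(exponent `ε = A'/2`). -/
theorem entropyBudgetEquipartition_assembly_proof :
    Summit.QuantumFields.YangMills.Theses.EntropyBudgetEquipartition.Assembly := by
  intro h1 hT hF G _ _ _ _ hG
  letI : MeasurableSpace G := borel G
  haveI : BorelSpace G := ⟨rfl⟩
  intro r
  obtain ⟨A', κ', hA', hκ', hfloor⟩ := hF G hG r (hT G hG r (h1 G hG r))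
  exact ⟨A' / 2, by linarith,
    massGapPowerDecayOf_of_polySeparationFloor r.ρ r.continuous (by decide) (by decide) hA' hκ' hfloor⟩

end Summit.QuantumFields.YangMills.Theorems
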